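import Summits.CriticalPhenomena.PercolationContinuityZ3.Theses.PercBudgetLadder
import Summits.CriticalPhenomena.PercolationContinuityZ3.Theses.PercAnnulusCrossing
import Literature.Probability.Percolation.MinOpenCut
import Literature.Probability.Percolation.CriticalContinuityProofs
import Literature.Probability.Percolation.SiteConnectionTools

/-!
# `PinholeClosing` (crux r3 of route PercBudgetLadder, item stmt-CriticalPhenomena-5249): negative-side support

Support file of the crux disprover (cdisprove seat), `sorry`-free.  Nothing here asserts a route item.

* §0 Dictionary (LOCAL NOTATION only, no declarations): `{ω : BondConfig (Site 3) | ∃ S : Finset (Sym2 (Site 3)), S.card ≤ k ∧ ¬ ∃ x ∈ box 3 (n), ∃ y ∈ innerBoundary (zdGraph 3) (box 3 (m)), (ω \ (↑S : Set (Sym2 (Site 3)))) ∈ openConnIn (↑(box 3 (m)) : Set (Site 3)) x y}` / `(bondPercolation (zdGraph 3) (criticalProbI 3)).real {ω : BondConfig (Site 3) | ∃ S : Finset (Sym2 (Site 3)), S.card ≤ k ∧ ¬ ∃ x ∈ box 3 (n), ∃ y ∈ innerBoundary (zdGraph 3) (box 3 (m)), (ω \ (↑S : Set (Sym2 (Site 3))))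 ∈ openConnIn (↑(box 3 (m)) : Set (Site 3)) x y}` — the budget-`k` blocked
  event / probability of the annulus `box 3 n → ∂ⁱⁿ box 3 m` inside `box 3 m` at `p_c(ℤ³)` (verbatim the items'
  set-builder); `pinholeClosing_iff`, `budgetTightness_iff` (`Iff.rfl`).
* §1 `blockedEv_eq_empty` (`m ≤ n`: EMPTY event), `blockProb_pos` (`n < m`: probability
  `≥ (1 - p_c)^{#edges touching box n} > 0`, finite energy), `blockProb_mono_budget`, `blockProb_mono_aspect`
  (a.s. first-exit decomposition: longer annuli are easier to block).
* §2 Load-bearing analysis of the crux: the guards `2 ≤ l`, `1 ≤ n` are not load-bearing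
  (`pinholeClosing_iff_withoutL`, `pinholeClosing_iff_withoutN`); `0 < c'` is the whole content
  (`pinholeClosing_withoutCpos_trivial`); dropping `0 < c` gives uniform budget-k blocking for every k
  (`pinholeClosing_withoutC_iff_uniform`), a uniform RSW-type bound.
* §3 Resistance certificate: `not_budgetTightness_false_and_pinholeClosing_false` (r2 and r3 cannot BOTH be
  false: if budgets are not tight the premise of r3 fails eventually and `c'` is a finite minimum of positive
  numbers) and `not_critAnnulusNonCrossing_of_not_pinholeClosing` (¬r3 refutes the uniform critical-annulus RSW
  bound X_B of route PercAnnulusCrossing); `kill_criterion` (refuting `n` are necessarily unbounded).  Hence a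
  refutation of r3 must at once prove r2 and refute X_B — two open problems.
-/

namespace Summit.CriticalPhenomena.PercolationContinuityZ3.Theorems.PinholeClosing.Negative

open MeasureTheory Filter
open Literature.Probability.Percolation Literature.Probability.LatticeModels
open Summit.CriticalPhenomena.PercolationContinuityZ3.Theses

noncomputable section

/-! ## §0 Dictionary -/

/-- The crux, restated over the dictionary (definitional). [folklore] -/
theorem pinholeClosing_iff :
    PercBudgetLadder.PinholeClosing ↔
      ∀ (k l : ℕ) (c : ℝ), 2 ≤ l → 0 < c → ∃ c' : ℝ, 0 < c' ∧ ∀ n : ℕ, 1 ≤ n →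
        c ≤ (bondPercolation (zdGraph 3) (criticalProbI 3)).real {ω : BondConfig (Site 3) | ∃ S : Finset (Sym2 (Site 3)), S.card ≤ k + 1 ∧ ¬ ∃ x ∈ box 3 (n), ∃ y ∈ innerBoundary (zdGraph 3) (box 3 (l * n)), (ω \ (↑S : Set (Sym2 (Site 3)))) ∈ openConnIn (↑(box 3 (l * n)) : Set (Site 3)) x y} → c' ≤ (bondPercolation (zdGraph 3) (criticalProbI 3)).real {ω : BondConfig (Site 3) | ∃ S : Finset (Sym2 (Site 3)), S.card ≤ k ∧ ¬ ∃ x ∈ box 3 (n), ∃ y ∈ innerBoundary (zdGraph 3) (box 3 (2 * l * n)), (ω \ (↑S : Set (Sym2 (Site 3)))) ∈ openConnIn (↑(box 3 (2 * l * n)) : Set (Site 3)) x y} :=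
  Iff.rfl

/-- Crux r2, restated over the dictionary (definitional). [folklore] -/
theorem budgetTightness_iff :
    PercBudgetLadder.BudgetTightness ↔
      ∃ (k l : ℕ) (c : ℝ), 2 ≤ l ∧ 0 < c ∧ ∀ N : ℕ, ∃ n : ℕ, N ≤ n ∧ c ≤ (bondPercolation (zdGraph 3) (criticalProbI 3)).real {ω : BondConfig (Site 3) | ∃ S : Finset (Sym2 (Site 3)), S.card ≤ k ∧ ¬ ∃ x ∈ box 3 (n), ∃ y ∈ innerBoundary (zdGraph 3) (box 3 (l * n)), (ω \ (↑S : Set (Sym2 (Site 3)))) ∈ openConnIn (↑(box 3 (l * n)) : Set (Site 3)) x y} :=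
  Iff.rfl

/-! ## §1 Elementary facts -/

/-- The corner `(m,m,m)` lies on the inner vertex boundary of `box 3 m`; in particular it is nonempty.
[folklore] -/
theorem corner_mem_innerBoundary (m : ℕ) :
    (fun _ => (m : ℤ)) ∈ innerBoundary (zdGraph 3) (box 3 m) := by
  rw [mem_innerBoundary_iff]
  refine ⟨by simp [mem_box], (fun _ => (m : ℤ)) + Pi.single 0 1, ?_, ?_⟩
  · simp only [mem_box, not_forall, not_and, not_le]
    exact ⟨0, fun _ => by simp⟩
  · rw [zdGraph_adj_iff]
    exact ⟨0, Or.inl rfl⟩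

/-- A vertex of `∂ⁱⁿ box 3 m` has a coordinate equal to `±m`, hence lies outside `box 3 n` for `n < m`.
[folklore] -/
theorem notMem_box_of_mem_innerBoundary {n m : ℕ} (h : n < m) {y : Site 3}
    (hy : y ∈ innerBoundary (zdGraph 3) (box 3 m)) : y ∉ box 3 n := by
  obtain ⟨i, hi | hi⟩ := exists_eq_of_mem_innerBoundary_box hy
  · rw [mem_box, not_forall]; exact ⟨i, by omega⟩
  · rw [mem_box, not_forall]; exact ⟨i, by omega⟩

/-- A vertex of `∂ⁱⁿ box 3 m` inside `box 3 n` forces `m ≤ n`. [folklore] -/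
theorem le_of_mem_innerBoundary_of_mem_box {n m : ℕ} {y : Site 3}
    (hy : y ∈ innerBoundary (zdGraph 3) (box 3 m)) (hyn : y ∈ box 3 n) : m ≤ n := by
  by_contra h
  exact notMem_box_of_mem_innerBoundary (not_le.1 h) hy hyn

/-- **Degenerate aspect.** For `m ≤ n` the blocked event is EMPTY: the corner of `box 3 m` lies in
`box 3 n` and is joined to itself by the empty (open) path, whatever is closed. [folklore] -/
theorem blockedEv_eq_empty {k n m : ℕ} (h : m ≤ n) : {ω : BondConfig (Site 3) | ∃ S : Finset (Sym2 (Site 3)), S.card ≤ k ∧ ¬ ∃ x ∈ box 3 (n), ∃ y ∈ innerBoundary (zdGraph 3) (box 3 (m)), (ω \ (↑S : Set (Sym2 (Site 3)))) ∈ openConnIn (↑(box 3 (m)) : Set (Site 3)) x y} = ∅ := by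
  ext ω
  simp only [Set.mem_setOf_eq, Set.mem_empty_iff_false, iff_false, not_exists, not_and]
  intro S _ hall
  have hxn : (fun _ => (m : ℤ)) ∈ box 3 n := by
    simp only [mem_box]
    intro i
    constructor <;> omega
  have hm : (fun _ => (m : ℤ)) ∈ (↑(box 3 m) : Set (Site 3)) := by
    simp [mem_box]
  exact hall _ hxn _ (corner_mem_innerBoundary m) ⟨hm, hm, SimpleGraph.Reachable.refl _⟩

/-- `(bondPercolation (zdGraph 3) (criticalProbI 3)).real {ω : BondConfig (Site 3) | ∃ S : Finset (Sym2 (Site 3)), S.card ≤ k ∧ ¬ ∃ x ∈ box 3 (n), ∃ y ∈ innerBoundary (zdGraph 3) (box 3 (m)), (ω \ (↑S : Set (Sym2 (Site 3)))) ∈ openConnIn (↑(box 3 (m)) : Set (Site 3)) x y} = 0` for `m ≤ n`. [folklore] -/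
theorem blockProb_eq_zero {k n m : ℕ} (h : m ≤ n) : (bondPercolation (zdGraph 3) (criticalProbI 3)).real {ω : BondConfig (Site 3) | ∃ S : Finset (Sym2 (Site 3)), S.card ≤ k ∧ ¬ ∃ x ∈ box 3 (n), ∃ y ∈ innerBoundary (zdGraph 3) (box 3 (m)), (ω \ (↑S : Set (Sym2 (Site 3)))) ∈ openConnIn (↑(box 3 (m)) : Set (Site 3)) x y} = 0 := by
  rw [blockedEv_eq_empty h, measureReal_empty]

/-- The edges of `ℤ³` touching `box 3 n` form an edge cutset, inside `box 3 m`, between `box 3 n` and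
`∂ⁱⁿ box 3 m` (`n < m`): the first edge of any crossing walk touches `box 3 n`. [folklore] -/
theorem isEdgeCutsetIn_edgesTouching {n m : ℕ} (h : n < m) :
    IsEdgeCutsetIn (zdGraph 3) ↑(box 3 m) ↑(box 3 n) ↑(innerBoundary (zdGraph 3) (box 3 m))
      ↑(edgesTouching (zdGraph 3) (box 3 n)) := by
  intro a b ha hb p
  cases p with
  | nil => exact absurd ha (notMem_box_of_mem_innerBoundary h hb)
  | cons hadj q =>
    rename_i c
    refine ⟨s(a, c), by simp, ?_⟩
    rw [Sym2.map_mk, Finset.mem_coe, mem_edgesTouching_iff]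
    exact ⟨(SimpleGraph.induce_adj.1 hadj), a, ha, Sym2.mem_mk_left _ _⟩

/-- `edgesTouching` consists of lattice edges. [folklore] -/
theorem coe_edgesTouching_subset (n : ℕ) :
    (↑(edgesTouching (zdGraph 3) (box 3 n)) : Set (Sym2 (Site 3))) ⊆ (zdGraph 3).edgeSet := by
  intro e he
  rw [Finset.mem_coe, mem_edgesTouching_iff] at he
  exact he.1

/-- If every lattice edge touching `box 3 n` is closed and `ω` is a lattice configuration, the annulus
`box 3 n → ∂ⁱⁿ box 3 m` (`n < m`) is blocked at budget `0` (hence at every budget). [folklore] -/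
theorem mem_blockedEv_of_disjoint {k n m : ℕ} (h : n < m) {ω : BondConfig (Site 3)}
    (hω : ω ⊆ (zdGraph 3).edgeSet) (hF : Disjoint (↑(edgesTouching (zdGraph 3) (box 3 n))) ω) :
    ω ∈ {ω : BondConfig (Site 3) | ∃ S : Finset (Sym2 (Site 3)), S.card ≤ k ∧ ¬ ∃ x ∈ box 3 (n), ∃ y ∈ innerBoundary (zdGraph 3) (box 3 (m)), (ω \ (↑S : Set (Sym2 (Site 3)))) ∈ openConnIn (↑(box 3 (m)) : Set (Site 3)) x y} := by
  have hcut := (isEdgeCutsetIn_edgesTouching h).isOpenCutsetIn_inter hω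
  rw [Set.disjoint_iff_inter_eq_empty.1 hF, isOpenCutsetIn_iff_not_exists] at hcut
  refine ⟨∅, by simp, ?_⟩
  simpa using hcut

/-- `P_{p_c}` is carried by lattice configurations. [folklore] -/
theorem ae_subset : ∀ᵐ ω ∂(bondPercolation (zdGraph 3) (criticalProbI 3)), ω ⊆ (zdGraph 3).edgeSet :=
  ProbabilityTheory.setBernoulli_ae_subset

/-- Monotonicity of `(bondPercolation (zdGraph 3) (criticalProbI 3)).real` along an a.e. inclusion valid on lattice configurations. [folklore] -/
theorem real_mono_of_lattice {A B : Set (BondConfig (Site 3))}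
    (h : ∀ ω, ω ⊆ (zdGraph 3).edgeSet → ω ∈ A → ω ∈ B) : (bondPercolation (zdGraph 3) (criticalProbI 3)).real A ≤ (bondPercolation (zdGraph 3) (criticalProbI 3)).real B := by
  have hle : A ≤ᵐ[(bondPercolation (zdGraph 3) (criticalProbI 3))] B := by
    filter_upwards [ae_subset] with ω hω hA using h ω hω hA
  simp only [measureReal_def]
  exact ENNReal.toReal_mono (measure_ne_top _ _) (measure_mono_ae hle)

/-- `p_c(ℤ³) < 1` (Grimmett 1999 Thm (1.10), proved in tree). [folklore] -/
theorem pc_lt_one : ((criticalProbI 3 : unitInterval) : ℝ) < 1 := by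
  rw [coe_criticalProbI]
  exact criticalProb_zd_lt_one (by norm_num)

/-- **Finite energy / positivity.** For `n < m` every budget-`k` blocked event has probability at least
`(1 - p_c)^{#edges touching box 3 n} > 0`.  Consequence: on any FINITE set of `n` the uniform constant
`c'` of the crux is automatic — only the asymptotics in `n` carry content. [folklore] -/
theorem blockProb_ge_pow {k n m : ℕ} (h : n < m) :
    (1 - (criticalProbI 3 : ℝ)) ^ (edgesTouching (zdGraph 3) (box 3 n)).card ≤ (bondPercolation (zdGraph 3) (criticalProbI 3)).real {ω : BondConfig (Site 3) | ∃ S : Finset (Sym2 (Site 3)), S.card ≤ k ∧ ¬ ∃ x ∈ box 3 (n), ∃ y ∈ innerBoundary (zdGraph 3) (box 3 (m)), (ω \ (↑S : Set (Sym2 (Site 3)))) ∈ openConnIn (↑(box 3 (m)) : Set (Site 3)) x y} := by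
  rw [← bondPercolation_real_setOf_disjoint (zdGraph 3) (criticalProbI 3) _ (coe_edgesTouching_subset n)]
  exact real_mono_of_lattice fun ω hω hd => mem_blockedEv_of_disjoint h hω hd

/-- `0 < (bondPercolation (zdGraph 3) (criticalProbI 3)).real {ω : BondConfig (Site 3) | ∃ S : Finset (Sym2 (Site 3)), S.card ≤ k ∧ ¬ ∃ x ∈ box 3 (n), ∃ y ∈ innerBoundary (zdGraph 3) (box 3 (m)), (ω \ (↑S : Set (Sym2 (Site 3)))) ∈ openConnIn (↑(box 3 (m)) : Set (Site 3)) x y}` for `n < m`. [folklore] -/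
theorem blockProb_pos {k n m : ℕ} (h : n < m) : 0 < (bondPercolation (zdGraph 3) (criticalProbI 3)).real {ω : BondConfig (Site 3) | ∃ S : Finset (Sym2 (Site 3)), S.card ≤ k ∧ ¬ ∃ x ∈ box 3 (n), ∃ y ∈ innerBoundary (zdGraph 3) (box 3 (m)), (ω \ (↑S : Set (Sym2 (Site 3)))) ∈ openConnIn (↑(box 3 (m)) : Set (Site 3)) x y} :=
  lt_of_lt_of_le (pow_pos (sub_pos.2 pc_lt_one) _) (blockProb_ge_pow h)

/-- `blockProb ≤ 1`. [folklore] -/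
theorem blockProb_le_one (k n m : ℕ) : (bondPercolation (zdGraph 3) (criticalProbI 3)).real {ω : BondConfig (Site 3) | ∃ S : Finset (Sym2 (Site 3)), S.card ≤ k ∧ ¬ ∃ x ∈ box 3 (n), ∃ y ∈ innerBoundary (zdGraph 3) (box 3 (m)), (ω \ (↑S : Set (Sym2 (Site 3)))) ∈ openConnIn (↑(box 3 (m)) : Set (Site 3)) x y} ≤ 1 :=
  measureReal_le_one

/-- `0 ≤ blockProb`. [folklore] -/
theorem blockProb_nonneg (k n m : ℕ) : 0 ≤ (bondPercolation (zdGraph 3) (criticalProbI 3)).real {ω : BondConfig (Site 3) | ∃ S : Finset (Sym2 (Site 3)), S.card ≤ k ∧ ¬ ∃ x ∈ box 3 (n), ∃ y ∈ innerBoundary (zdGraph 3) (box 3 (m)), (ω \ (↑S : Set (Sym2 (Site 3)))) ∈ openConnIn (↑(box 3 (m)) : Set (Site 3)) x y} :=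
  measureReal_nonneg

/-- Budget monotonicity: more closures allowed, larger event. [folklore] -/
theorem blockedEv_mono_budget {k k' : ℕ} (h : k ≤ k') (n m : ℕ) : {ω : BondConfig (Site 3) | ∃ S : Finset (Sym2 (Site 3)), S.card ≤ k ∧ ¬ ∃ x ∈ box 3 (n), ∃ y ∈ innerBoundary (zdGraph 3) (box 3 (m)), (ω \ (↑S : Set (Sym2 (Site 3)))) ∈ openConnIn (↑(box 3 (m)) : Set (Site 3)) x y} ⊆ {ω : BondConfig (Site 3) | ∃ S : Finset (Sym2 (Site 3)), S.card ≤ k' ∧ ¬ ∃ x ∈ box 3 (n), ∃ y ∈ innerBoundary (zdGraph 3) (box 3 (m)), (ω \ (↑S : Set (Sym2 (Site 3)))) ∈ openConnIn (↑(box 3 (m)) : Set (Site 3)) x y} := by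
  rintro ω ⟨S, hS, hb⟩
  exact ⟨S, hS.trans h, hb⟩

/-- `blockProb` is monotone in the budget. [folklore] -/
theorem blockProb_mono_budget {k k' : ℕ} (h : k ≤ k') (n m : ℕ) : (bondPercolation (zdGraph 3) (criticalProbI 3)).real {ω : BondConfig (Site 3) | ∃ S : Finset (Sym2 (Site 3)), S.card ≤ k ∧ ¬ ∃ x ∈ box 3 (n), ∃ y ∈ innerBoundary (zdGraph 3) (box 3 (m)), (ω \ (↑S : Set (Sym2 (Site 3)))) ∈ openConnIn (↑(box 3 (m)) : Set (Site 3)) x y} ≤ (bondPercolation (zdGraph 3) (criticalProbI 3)).real {ω : BondConfig (Site 3) | ∃ S : Finset (Sym2 (Site 3)), S.card ≤ k' ∧ ¬ ∃ x ∈ box 3 (n), ∃ y ∈ innerBoundary (zdGraph 3) (box 3 (m)), (ω \ (↑S : Set (Sym2 (Site 3)))) ∈ openConnIn (↑(box 3 (m)) : Set (Site 3)) x y} :=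
  measureReal_mono (blockedEv_mono_budget h n m)

/-- **First-exit lemma for the annulus.** On a lattice configuration, an open crossing inside `box 3 M'`
from `x ∈ box 3 M` to `∂ⁱⁿ box 3 M'` (`M ≤ M'`) has an initial segment inside `box 3 M` from `x` to
`∂ⁱⁿ box 3 M`. [folklore] -/
theorem exists_crossing_of_crossing {M M' : ℕ} (hM : M ≤ M') {ω : BondConfig (Site 3)}
    (hω : ω ⊆ (zdGraph 3).edgeSet) {x y : Site 3} (hx : x ∈ box 3 M)
    (hy : y ∈ innerBoundary (zdGraph 3) (box 3 M'))
    (hxy : ω ∈ openConnIn (↑(box 3 M') : Set (Site 3)) x y) :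
    ∃ z ∈ innerBoundary (zdGraph 3) (box 3 M), ω ∈ openConnIn (↑(box 3 M) : Set (Site 3)) x z := by
  obtain ⟨hxS, hyS, hr⟩ := hxy
  by_cases hyM : y ∈ box 3 M
  · have hMM : M' ≤ M := le_of_mem_innerBoundary_of_mem_box hy hyM
    obtain rfl : M = M' := le_antisymm hM hMM
    exact ⟨y, hy, hxS, hyS, hr⟩
  · have hle : openGraph ω ≤ zdGraph 3 := fun a b hab => hω ((openGraph_adj _ _ _).1 hab).1
    have hr' : (openGraph ω).Reachable x y :=
      hr.map (SimpleGraph.Embedding.induce (↑(box 3 M') : Set (Site 3))).toHom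
    obtain ⟨w⟩ := hr'
    obtain ⟨z, hz, hxM, hzM, hreach⟩ := exists_innerBoundary_reachable_of_walk hle (box 3 M) w hx hyM
    exact ⟨z, hz, hxM, hzM, hreach⟩

/-- **Aspect monotonicity (a.s.).** On lattice configurations, blocking the annulus `box n → ∂ box M`
blocks every longer annulus `box n → ∂ box M'`, `n ≤ M ≤ M'`, with the same closed set. [folklore] -/
theorem blockedEv_mono_aspect {k n M M' : ℕ} (hnM : n ≤ M) (hM : M ≤ M') {ω : BondConfig (Site 3)}
    (hω : ω ⊆ (zdGraph 3).edgeSet) (h : ω ∈ {ω : BondConfig (Site 3) | ∃ S : Finset (Sym2 (Site 3)), S.card ≤ k ∧ ¬ ∃ x ∈ box 3 (n), ∃ y ∈ innerBoundary (zdGraph 3) (box 3 (M)), (ω \ (↑S : Set (Sym2 (Site 3)))) ∈ openConnIn (↑(box 3 (M)) : Set (Site 3)) x y}) : ω ∈ {ω : BondConfig (Site 3) | ∃ S : Finset (Sym2 (Site 3)), S.card ≤ k ∧ ¬ ∃ x ∈ box 3 (n), ∃ y ∈ innerBoundary (zdGraph 3) (box 3 (M')), (ω \ (↑S : Set (Sym2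 (Site 3)))) ∈ openConnIn (↑(box 3 (M')) : Set (Site 3)) x y} := by
  obtain ⟨S, hS, hb⟩ := h
  refine ⟨S, hS, ?_⟩
  rintro ⟨x, hx, y, hy, hxy⟩
  have hω' : ω \ ↑S ⊆ (zdGraph 3).edgeSet := Set.sdiff_subset.trans hω
  obtain ⟨z, hz, hxz⟩ := exists_crossing_of_crossing hM hω' (box_mono 3 hnM hx) hy hxy
  exact hb ⟨x, hx, z, hz, hxz⟩

/-- `(bondPercolation (zdGraph 3) (criticalProbI 3)).real {ω : BondConfig (Site 3) | ∃ S : Finset (Sym2 (Site 3)), S.card ≤ k ∧ ¬ ∃ x ∈ box 3 (n), ∃ y ∈ innerBoundary (zdGraph 3) (box 3 (M)), (ω \ (↑S : Set (Sym2 (Site 3)))) ∈ openConnIn (↑(box 3 (M)) : Set (Site 3)) x y} ≤ (bondPercolation (zdGraph 3) (criticalProbI 3)).real {ω : BondConfig (Site 3) | ∃ S : Finset (Sym2 (Site 3)), S.card ≤ k ∧ ¬ ∃ x ∈ box 3 (n), ∃ y ∈ innerBoundary (zdGraph 3) (box 3 (M')), (ω \ (↑S : Set (Sym2 (Site 3))))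 ∈ openConnIn (↑(box 3 (M')) : Set (Site 3)) x y}` for `n ≤ M ≤ M'`. [folklore] -/
theorem blockProb_mono_aspect {k n M M' : ℕ} (hnM : n ≤ M) (hM : M ≤ M') :
    (bondPercolation (zdGraph 3) (criticalProbI 3)).real {ω : BondConfig (Site 3) | ∃ S : Finset (Sym2 (Site 3)), S.card ≤ k ∧ ¬ ∃ x ∈ box 3 (n), ∃ y ∈ innerBoundary (zdGraph 3) (box 3 (M)), (ω \ (↑S : Set (Sym2 (Site 3)))) ∈ openConnIn (↑(box 3 (M)) : Set (Site 3)) x y} ≤ (bondPercolation (zdGraph 3) (criticalProbI 3)).real {ω : BondConfig (Site 3) | ∃ S : Finset (Sym2 (Site 3)), S.card ≤ k ∧ ¬ ∃ x ∈ box 3 (n), ∃ y ∈ innerBoundary (zdGraph 3) (box 3 (M')), (ω \ (↑S : Set (Sym2 (Site 3)))) ∈ openConnIn (↑(box 3 (M')) : Set (Site 3)) x y} :=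
  real_mono_of_lattice fun _ hω h => blockedEv_mono_aspect hnM hM hω h

/-- A positive lower bound on finitely many positive reals indexed by `1 ≤ n < N`. [folklore] -/
theorem exists_pos_lower_bound (f : ℕ → ℝ) (hf : ∀ n, 1 ≤ n → 0 < f n) (N : ℕ) :
    ∃ c' : ℝ, 0 < c' ∧ ∀ n, 1 ≤ n → n < N → c' ≤ f n := by
  induction N with
  | zero => exact ⟨1, one_pos, fun n _ h => absurd h (Nat.not_lt_zero n)⟩
  | succ N ih =>
    obtain ⟨c', hc', hN⟩ := ih
    rcases Nat.eq_zero_or_pos N with rfl | hNpos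
    · exact ⟨1, one_pos, fun n h1 h2 => by omega⟩
    · refine ⟨min c' (f N), lt_min hc' (hf N hNpos), fun n h1 h2 => ?_⟩
      rcases Nat.lt_succ_iff_lt_or_eq.1 h2 with hlt | rfl
      · exact (min_le_left _ _).trans (hN n h1 hlt)
      · exact min_le_right _ _

/-! ## §2 Load-bearing analysis (no auxiliary `def : Prop`; each variant is displayed in the statement) -/

/-- **`2 ≤ l` is not load-bearing**: the crux is equivalent to its guard-free form (for `l ≤ 1` the premise
event is empty, `blockProb_eq_zero`, so the new instances are vacuous). [folklore] -/
theorem pinholeClosing_iff_withoutL :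
    PercBudgetLadder.PinholeClosing ↔
      ∀ (k l : ℕ) (c : ℝ), 0 < c → ∃ c' : ℝ, 0 < c' ∧ ∀ n : ℕ, 1 ≤ n →
        c ≤ (bondPercolation (zdGraph 3) (criticalProbI 3)).real {ω : BondConfig (Site 3) | ∃ S : Finset (Sym2 (Site 3)), S.card ≤ k + 1 ∧ ¬ ∃ x ∈ box 3 (n), ∃ y ∈ innerBoundary (zdGraph 3) (box 3 (l * n)), (ω \ (↑S : Set (Sym2 (Site 3)))) ∈ openConnIn (↑(box 3 (l * n)) : Set (Site 3)) x y} → c' ≤ (bondPercolation (zdGraph 3) (criticalProbI 3)).real {ω : BondConfig (Site 3) | ∃ S : Finset (Sym2 (Site 3)), S.card ≤ k ∧ ¬ ∃ x ∈ box 3 (n), ∃ y ∈ innerBoundary (zdGraph 3) (box 3 (2 * l * n)), (ω \ (↑S : Set (Sym2 (Site 3)))) ∈ openConnIn (↑(box 3 (2 * l * n)) : Set (Site 3)) x y} := by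
  rw [pinholeClosing_iff]
  constructor
  · intro h k l c hc
    by_cases hl : 2 ≤ l
    · exact h k l c hl hc
    · refine ⟨1, one_pos, fun n hn hprem => ?_⟩
      have : (bondPercolation (zdGraph 3) (criticalProbI 3)).real {ω : BondConfig (Site 3) | ∃ S : Finset (Sym2 (Site 3)), S.card ≤ k + 1 ∧ ¬ ∃ x ∈ box 3 (n), ∃ y ∈ innerBoundary (zdGraph 3) (box 3 (l * n)), (ω \ (↑S : Set (Sym2 (Site 3)))) ∈ openConnIn (↑(box 3 (l * n)) : Set (Site 3)) x y} = 0 := blockProb_eq_zero (by nlinarith)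
      linarith
  · exact fun h k l c _ hc => h k l c hc

/-- **`1 ≤ n` is not load-bearing**: at `n = 0` both boxes are `{0}` and the premise event is empty.
[folklore] -/
theorem pinholeClosing_iff_withoutN :
    PercBudgetLadder.PinholeClosing ↔
      ∀ (k l : ℕ) (c : ℝ), 2 ≤ l → 0 < c → ∃ c' : ℝ, 0 < c' ∧ ∀ n : ℕ,
        c ≤ (bondPercolation (zdGraph 3) (criticalProbI 3)).real {ω : BondConfig (Site 3) | ∃ S : Finset (Sym2 (Site 3)), S.card ≤ k + 1 ∧ ¬ ∃ x ∈ box 3 (n), ∃ y ∈ innerBoundary (zdGraph 3) (box 3 (l * n)), (ω \ (↑S : Set (Sym2 (Site 3)))) ∈ openConnIn (↑(box 3 (l * n)) : Set (Site 3)) x y} → c' ≤ (bondPercolation (zdGraph 3) (criticalProbI 3)).real {ω : BondConfig (Site 3) | ∃ S : Finset (Sym2 (Site 3)), S.card ≤ k ∧ ¬ ∃ x ∈ box 3 (n), ∃ y ∈ innerBoundary (zdGraph 3) (box 3 (2 * l * n)), (ω \ (↑S : Set (Sym2 (Site 3)))) ∈ openConnIn (↑(box 3 (2 * l * n)) : Set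 (Site 3)) x y} := by
  rw [pinholeClosing_iff]
  constructor
  · intro h k l c hl hc
    obtain ⟨c', hc', hn⟩ := h k l c hl hc
    refine ⟨c', hc', fun n hprem => ?_⟩
    rcases Nat.eq_zero_or_pos n with rfl | hnpos
    · have : (bondPercolation (zdGraph 3) (criticalProbI 3)).real {ω : BondConfig (Site 3) | ∃ S : Finset (Sym2 (Site 3)), S.card ≤ k + 1 ∧ ¬ ∃ x ∈ box 3 (0), ∃ y ∈ innerBoundary (zdGraph 3) (box 3 (l * 0)), (ω \ (↑S : Set (Sym2 (Site 3)))) ∈ openConnIn (↑(box 3 (l * 0)) : Set (Site 3)) x y} = 0 := blockProb_eq_zero (by simp)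
      linarith
    · exact hn n hnpos hprem
  · exact fun h k l c hl hc => let ⟨c', hc', hn⟩ := h k l c hl hc; ⟨c', hc', fun n _ => hn n⟩

/-- **`0 < c'` is the entire content**: with the positivity of the conclusion constant dropped, `c' = 0`
works. [folklore] -/
theorem pinholeClosing_withoutCpos_trivial :
    ∀ (k l : ℕ) (c : ℝ), 2 ≤ l → 0 < c → ∃ c' : ℝ, ∀ n : ℕ, 1 ≤ n →
      c ≤ (bondPercolation (zdGraph 3) (criticalProbI 3)).real {ω : BondConfig (Site 3) | ∃ S : Finset (Sym2 (Site 3)), S.card ≤ k + 1 ∧ ¬ ∃ x ∈ box 3 (n), ∃ y ∈ innerBoundary (zdGraph 3) (box 3 (l * n)), (ω \ (↑S : Set (Sym2 (Site 3)))) ∈ openConnIn (↑(box 3 (l * n)) : Set (Site 3)) x y} → c' ≤ (bondPercolation (zdGraph 3) (criticalProbI 3)).real {ω : BondConfig (Site 3) | ∃ S : Finset (Sym2 (Site 3)), S.card ≤ k ∧ ¬ ∃ x ∈ box 3 (n), ∃ y ∈ innerBoundary (zdGraph 3) (box 3 (2 * l * n)), (ω \ (↑S : Set (Sym2 (Site 3))))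 ∈ openConnIn (↑(box 3 (2 * l * n)) : Set (Site 3)) x y} :=
  fun k l _ _ _ => ⟨0, fun n _ _ => blockProb_nonneg k n (2 * l * n)⟩

/-- **The premise (with `0 < c`) is what keeps r3 below the target**: with `0 < c` dropped the crux is
EQUIVALENT to uniform budget-`k` blocking at every aspect `2l ≥ 4` for every `k` (take `c = 0`: the premise
is then trivially true) — at `k = 0` a uniform RSW lower bound that already implies the route target without
r2. [folklore] -/
theorem pinholeClosing_withoutC_iff_uniform :
    (∀ (k l : ℕ) (c : ℝ), 2 ≤ l → ∃ c' : ℝ, 0 < c' ∧ ∀ n : ℕ, 1 ≤ n →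
        c ≤ (bondPercolation (zdGraph 3) (criticalProbI 3)).real {ω : BondConfig (Site 3) | ∃ S : Finset (Sym2 (Site 3)), S.card ≤ k + 1 ∧ ¬ ∃ x ∈ box 3 (n), ∃ y ∈ innerBoundary (zdGraph 3) (box 3 (l * n)), (ω \ (↑S : Set (Sym2 (Site 3)))) ∈ openConnIn (↑(box 3 (l * n)) : Set (Site 3)) x y} → c' ≤ (bondPercolation (zdGraph 3) (criticalProbI 3)).real {ω : BondConfig (Site 3) | ∃ S : Finset (Sym2 (Site 3)), S.card ≤ k ∧ ¬ ∃ x ∈ box 3 (n), ∃ y ∈ innerBoundary (zdGraph 3) (box 3 (2 * l * n)), (ω \ (↑S : Set (Sym2 (Site 3)))) ∈ openConnIn (↑(box 3 (2 * l * n)) : Set (Site 3)) x y}) ↔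
      ∀ (k l : ℕ), 2 ≤ l → ∃ c' : ℝ, 0 < c' ∧ ∀ n : ℕ, 1 ≤ n → c' ≤ (bondPercolation (zdGraph 3) (criticalProbI 3)).real {ω : BondConfig (Site 3) | ∃ S : Finset (Sym2 (Site 3)), S.card ≤ k ∧ ¬ ∃ x ∈ box 3 (n), ∃ y ∈ innerBoundary (zdGraph 3) (box 3 (2 * l * n)), (ω \ (↑S : Set (Sym2 (Site 3)))) ∈ openConnIn (↑(box 3 (2 * l * n)) : Set (Site 3)) x y} := by
  constructor
  · intro h k l hl
    obtain ⟨c', hc', hstep⟩ := h k l 0 hl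
    exact ⟨c', hc', fun n hn => hstep n hn (blockProb_nonneg _ _ _)⟩
  · intro h k l c hl
    obtain ⟨c', hc', hstep⟩ := h k l hl
    exact ⟨c', hc', fun n hn _ => hstep n hn⟩

/-! ## §3 Resistance certificate -/

/-- **r2 and r3 cannot both be false.**  If the critical budgets are NOT tight (¬BudgetTightness: for all
k, l, c the budget-k blocking probability at aspect l is eventually < c) then the premise of PinholeClosing at
(k+1, l, c) holds for only finitely many n, on which `c'` = a finite minimum of the positive numbers
`(bondPercolation (zdGraph 3) (criticalProbI 3)).real {ω : BondConfig (Site 3) | ∃ S : Finset (Sym2 (Site 3)), S.card ≤ k ∧ ¬ ∃ x ∈ box 3 (n), ∃ y ∈ innerBoundary (zdGraph 3) (box 3 (2ln)), (ω \ (↑S : Set (Sym2 (Site 3)))) ∈ openConnIn (↑(box 3 (2ln)) : Set (Site 3)) x y}` (`blockProb_pos`) works; so ¬r2 ∧ ¬r3 is contradictory.  A refutation of r3 is therefore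
a PROOF of r2 (bounded-budget tightness at p_c(ℤ³), open). [folklore] -/
theorem not_budgetTightness_false_and_pinholeClosing_false :
    ¬ (¬ PercBudgetLadder.BudgetTightness ∧ ¬ PercBudgetLadder.PinholeClosing) := by
  rintro ⟨hBT, hPC⟩
  rw [pinholeClosing_iff] at hPC
  rw [budgetTightness_iff] at hBT
  refine hPC fun k l c hl hc => ?_
  -- from ¬r2 at (k+1, l, c): the premise of r3 fails from some N on
  have hN : ∃ N : ℕ, ∀ n : ℕ, N ≤ n → (bondPercolation (zdGraph 3) (criticalProbI 3)).real {ω : BondConfig (Site 3) | ∃ S : Finset (Sym2 (Site 3)), S.card ≤ k + 1 ∧ ¬ ∃ x ∈ box 3 (n), ∃ y ∈ innerBoundary (zdGraph 3) (box 3 (l * n)), (ω \ (↑S : Set (Sym2 (Site 3)))) ∈ openConnIn (↑(box 3 (l * n)) : Set (Site 3)) x y} < c := by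
    by_contra hcon
    refine hBT ⟨k + 1, l, c, hl, hc, fun N => ?_⟩
    by_contra h2
    exact hcon ⟨N, fun n hn => lt_of_not_ge fun hle => h2 ⟨n, hn, hle⟩⟩
  obtain ⟨N, hN⟩ := hN
  obtain ⟨c', hc', hmin⟩ := exists_pos_lower_bound (fun n => (bondPercolation (zdGraph 3) (criticalProbI 3)).real {ω : BondConfig (Site 3) | ∃ S : Finset (Sym2 (Site 3)), S.card ≤ k ∧ ¬ ∃ x ∈ box 3 (n), ∃ y ∈ innerBoundary (zdGraph 3) (box 3 (2 * l * n)), (ω \ (↑S : Set (Sym2 (Site 3)))) ∈ openConnIn (↑(box 3 (2 * l * n)) : Set (Site 3)) x y})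
    (fun n hn => blockProb_pos (by nlinarith)) N
  refine ⟨c', hc', fun n hn hprem => hmin n hn ?_⟩
  by_contra hnN
  exact absurd hprem (not_le.2 (hN n (not_lt.1 hnN)))

/-- `P(¬A) ≥ 1 - P(A)` for the outer measure (no measurability needed). [folklore] -/
theorem one_sub_le_real_compl (A : Set (BondConfig (Site 3))) : 1 - (bondPercolation (zdGraph 3) (criticalProbI 3)).real A ≤ (bondPercolation (zdGraph 3) (criticalProbI 3)).real Aᶜ := by
  have h1 : (bondPercolation (zdGraph 3) (criticalProbI 3)).real Set.univ ≤ (bondPercolation (zdGraph 3) (criticalProbI 3)).real A + (bondPercolation (zdGraph 3) (criticalProbI 3)).real Aᶜ := by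
    rw [← Set.union_compl_self A]; exact measureReal_union_le _ _
  have hu : (bondPercolation (zdGraph 3) (criticalProbI 3)).real Set.univ = 1 := by simp
  linarith

/-- Budget `0` is the plain blocked event (the only `S` with `#S ≤ 0` is `∅`). [folklore] -/
theorem blockedEv_zero (n m : ℕ) :
    {ω : BondConfig (Site 3) | ∃ S : Finset (Sym2 (Site 3)), S.card ≤ 0 ∧ ¬ ∃ x ∈ box 3 (n), ∃ y ∈ innerBoundary (zdGraph 3) (box 3 (m)), (ω \ (↑S : Set (Sym2 (Site 3)))) ∈ openConnIn (↑(box 3 (m)) : Set (Site 3)) x y} = {ω | ∃ x ∈ box 3 n, ∃ y ∈ innerBoundary (zdGraph 3) (box 3 m),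
      ω ∈ openConnIn ↑(box 3 m) x y}ᶜ := by
  ext ω
  simp only [Set.mem_setOf_eq, Nat.le_zero, Finset.card_eq_zero, exists_eq_left,
    Finset.coe_empty, Set.sdiff_empty, Set.mem_compl_iff]

/-- **¬r3 refutes X_B.**  The uniform critical-annulus RSW bound of route PercAnnulusCrossing
(`CritAnnulusNonCrossing`: P_{p_c}(box n ↔ ∂ box 2n in box 2n) ≤ 1 - c₀ for all n ≥ 1) would give the conclusion
of r3 with `c' = c₀` for every k, l ≥ 1 and n, premise or not (budget 0 ≤ budget k, aspect 2 ≤ aspect 2l by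
`blockProb_mono_aspect`).  So r3 is WEAKER than the standing RSW crux X_B, and a refutation of r3 refutes X_B
(open). [folklore] -/
theorem not_critAnnulusNonCrossing_of_not_pinholeClosing (h : ¬ PercBudgetLadder.PinholeClosing) :
    ¬ PercAnnulusCrossing.CritAnnulusNonCrossing := by
  rintro ⟨c₀, hc₀, hRSW⟩
  rw [pinholeClosing_iff] at h
  refine h fun k l c hl _ => ⟨c₀, hc₀, fun n hn _ => ?_⟩
  calc c₀ ≤ 1 - (bondPercolation (zdGraph 3) (criticalProbI 3)).real {ω | ∃ x ∈ box 3 n, ∃ y ∈ innerBoundary (zdGraph 3) (box 3 (2 * n)),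
            ω ∈ openConnIn ↑(box 3 (2 * n)) x y} := by linarith [hRSW n hn]
    _ ≤ (bondPercolation (zdGraph 3) (criticalProbI 3)).real {ω : BondConfig (Site 3) | ∃ S : Finset (Sym2 (Site 3)), S.card ≤ 0 ∧ ¬ ∃ x ∈ box 3 (n), ∃ y ∈ innerBoundary (zdGraph 3) (box 3 (2 * n)), (ω \ (↑S : Set (Sym2 (Site 3)))) ∈ openConnIn (↑(box 3 (2 * n)) : Set (Site 3)) x y} := by
        rw [blockedEv_zero]; exact one_sub_le_real_compl _
    _ ≤ (bondPercolation (zdGraph 3) (criticalProbI 3)).real {ω : BondConfig (Site 3) | ∃ S : Finset (Sym2 (Site 3)), S.card ≤ 0 ∧ ¬ ∃ x ∈ box 3 (n), ∃ y ∈ innerBoundary (zdGraph 3) (box 3 (2 * l * n)), (ω \ (↑S : Set (Sym2 (Site 3)))) ∈ openConnIn (↑(box 3 (2 * l * n)) : Set (Site 3)) x y} := blockProb_mono_aspect (by omega) (by nlinarith)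
    _ ≤ (bondPercolation (zdGraph 3) (criticalProbI 3)).real {ω : BondConfig (Site 3) | ∃ S : Finset (Sym2 (Site 3)), S.card ≤ k ∧ ¬ ∃ x ∈ box 3 (n), ∃ y ∈ innerBoundary (zdGraph 3) (box 3 (2 * l * n)), (ω \ (↑S : Set (Sym2 (Site 3)))) ∈ openConnIn (↑(box 3 (2 * l * n)) : Set (Site 3)) x y} := blockProb_mono_budget (Nat.zero_le k) _ _

/-- **Kill criterion, made precise.**  r3 fails only if for some k, l ≥ 2, c > 0 there are qualifying n
(premise ≥ c) with ARBITRARILY SMALL budget-k blocking at aspect 2l, and by `blockProb_pos` such n are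
necessarily UNBOUNDED (for every N and ε some qualifying n ≥ N has (bondPercolation (zdGraph 3) (criticalProbI 3)).real {ω : BondConfig (Site 3) | ∃ S : Finset (Sym2 (Site 3)), S.card ≤ k ∧ ¬ ∃ x ∈ box 3 (n), ∃ y ∈ innerBoundary (zdGraph 3) (box 3 (2ln)), (ω \ (↑S : Set (Sym2 (Site 3)))) ∈ openConnIn (↑(box 3 (2ln)) : Set (Site 3)) x y} < ε): a refuting
witness is an asymptotic statement about P_{p_c(ℤ³)} along a subsequence, out of reach of `decide`, small
models or extreme-parameter instances. [folklore] -/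
theorem kill_criterion (h : ¬ PercBudgetLadder.PinholeClosing) :
    ∃ (k l : ℕ) (c : ℝ), 2 ≤ l ∧ 0 < c ∧ ∀ (N : ℕ) (ε : ℝ), 0 < ε →
      ∃ n : ℕ, N ≤ n ∧ c ≤ (bondPercolation (zdGraph 3) (criticalProbI 3)).real {ω : BondConfig (Site 3) | ∃ S : Finset (Sym2 (Site 3)), S.card ≤ k + 1 ∧ ¬ ∃ x ∈ box 3 (n), ∃ y ∈ innerBoundary (zdGraph 3) (box 3 (l * n)), (ω \ (↑S : Set (Sym2 (Site 3)))) ∈ openConnIn (↑(box 3 (l * n)) : Set (Site 3)) x y} ∧ (bondPercolation (zdGraph 3) (criticalProbI 3)).real {ω : BondConfig (Site 3) | ∃ S : Finset (Sym2 (Site 3)), S.card ≤ k ∧ ¬ ∃ x ∈ box 3 (n), ∃ y ∈ innerBoundary (zdGraph 3) (box 3 (2 * l * n)), (ω \ (↑S : Set (Sym2 (Site 3)))) ∈ openConnIn (↑(box 3 (2 * l * n)) : Set (Site 3)) x y} < ε := by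
  rw [pinholeClosing_iff] at h
  by_contra hall
  refine h fun k l c hl hc => ?_
  by_contra h1
  refine hall ⟨k, l, c, hl, hc, fun N ε hε => ?_⟩
  obtain ⟨c₁, hc₁, hmin⟩ := exists_pos_lower_bound (fun n => (bondPercolation (zdGraph 3) (criticalProbI 3)).real {ω : BondConfig (Site 3) | ∃ S : Finset (Sym2 (Site 3)), S.card ≤ k ∧ ¬ ∃ x ∈ box 3 (n), ∃ y ∈ innerBoundary (zdGraph 3) (box 3 (2 * l * n)), (ω \ (↑S : Set (Sym2 (Site 3)))) ∈ openConnIn (↑(box 3 (2 * l * n)) : Set (Site 3)) x y})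
    (fun n hn => blockProb_pos (by nlinarith)) N
  by_contra h2
  refine h1 ⟨min c₁ ε, lt_min hc₁ hε, fun n hn hprem => ?_⟩
  by_contra hlt
  rw [not_le] at hlt
  rcases lt_or_ge n N with hnN | hnN
  · exact absurd (lt_of_lt_of_le hlt (min_le_left _ _)) (not_lt.2 (hmin n hn hnN))
  · exact h2 ⟨n, hnN, hprem, lt_of_lt_of_le hlt (min_le_right _ _)⟩

end

end Summit.CriticalPhenomena.PercolationContinuityZ3.Theorems.PinholeClosing.Negative
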